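import Summits.QuantumFields.YangMills.Theses.LangevinControlUV
import Literature.MathematicalPhysics.QuantumFieldTheory.DiagonalLatticeClustering

/-!
# Crux `GapToContinuum` (stmt-QuantumFields-8896) — RESTATEMENT R5, named form (lead a2)

Evidence file (elaborates; no `sorry`).  Lead a1's `RestatementA1.lean` had to INLINE the diagonal
lattice clustering clause because `DiagonalLatticeClustering.lean` (p126606) was still review-queued;
it has since LANDED (`Literature.MathematicalPhysics.QuantumFieldTheory.SpeciesScheme.HasDiagClustering`,
`IsYangMillsFor.hasMassGap_of_hasDiagClustering`).  So the recommended re-type of the crux is now a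
paste-ready, fully named statement closed by a ONE-LINE tree term:

* `GapToContinuumR5` — the text to paste as `def GapToContinuum` (fully qualified, same binder list
  as the typed item; the hypothesis `HasLatticeMassGap r sch Δ` is REPLACED by
  `sch.HasDiagClustering r Δ`): PROVED, `gapToContinuumR5_holds`.
* `OSLegsAtWeakCouplingR5` — stmt-QuantumFields-16207 (`OSLegsAtWeakCouplingC`) VERBATIM with the last
  conjunct `∃ Δ > 0, HasLatticeMassGap r sch Δ` strengthened to
  `∃ Δ > 0, HasLatticeMassGap r sch Δ ∧ sch.HasDiagClustering r Δ` (the scheme is existential there: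
  whoever builds `sch` chooses `L_k`, `c_s(k)`, `β_k`); it implies the current 16207
  (`osLegsAtWeakCouplingC_of_R5`).
* `closes_R5 : FemtoCurvatureTwoPointC → FemtoCurvatureSkewnessC → LatticeGapInUVUnitsC →
  OSLegsAtWeakCouplingR5 → YangMills` — the deciding theorem re-elaborates with FOUR hypotheses
  (or five, keeping `GapToContinuumR5` as a hypothesis discharged by `gapToContinuumR5_holds`:
  `closes_R5'`).

Why re-type rather than prove/refute the typed item: see `Lines/*dead*.md` (leads -0, c1, a1, a2),
`TRIAGE-r1-*.md`, `Round2Ideator4.md`, `StructuralFindings-ideator5.md`, `Disproof.lean` — the typed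
hypothesis `HasLatticeMassGap` (per-pair constants AND thresholds, sup-norm currency, symmetric odd
time-periodic tori, `β` of either sign) cannot be converted into the OS-currency, tensor-wise clustering
the conclusion needs (D1 β-sign, D2 per-pair thresholds vs the k-growing family of translated product
species, D3 own-torus inheritance), while a `¬` witness needs a gapless Wilson continuum limit (not
constructible).  `lean check`: rc 0 expected, 0 sorries.
-/

noncomputable section

open scoped SchwartzMap
open MeasureTheory Filter Topology
open Literature.MathematicalPhysics.AQFT Literature.MathematicalPhysics.QuantumLattice
open Literature.MathematicalPhysics.QuantumFieldTheory Literature.Probability.LatticeModels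

namespace Summit.QuantumFields.YangMills.Cruxes.GapToContinuum.RestatementA2

open Summit.QuantumFields.YangMills.Theses.LangevinControlUV

/-- **R5 — the restated crux, paste-ready** (replace the body of `def GapToContinuum` by this text):
for every compact `G`, `r`, `sch`, `T` and `Δ > 0`, `IsYangMillsFor r sch T` and the diagonal lattice
clustering `sch.HasDiagClustering r Δ` (one slab-ordered real factor datum at a time, FREE constant,
eventually in `k`, slack `ε`, on the scheme's own tori) imply `T.HasMassGap Δ`. -/
def GapToContinuumR5 : Prop :=
  ∀ (G : Type) [Group G] [TopologicalSpace G] [IsTopologicalGroup G] [CompactSpace G] [MeasurableSpace G] [BorelSpace G] (r : Literature.MathematicalPhysics.QuantumFieldTheory.LatticeRep G) (sch : Literature.MathematicalPhysics.QuantumFieldTheory.SpeciesScheme (Literature.MathematicalPhysics.QuantumFieldTheory.YMSpecies G)) (T : Literature.MathematicalPhysics.QuantumFieldTheory.OSData (Literature.MathematicalPhysics.QuantumFieldTheory.YMSpecies G) 4) (Δ : ℝ), 0 < Δ → Literature.MathematicalPhysics.QuantumFieldTheory.IsYangMillsFor r sch T → sch.HasDiagClustering r Δ → T.HasMassGap 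Δ

/-- **R5 is a theorem of the tree** (`IsYangMillsFor.hasMassGap_of_hasDiagClustering`, p126606, resting
on `OSData.hasMassGap_of_diagBound`, p124697 + p124879). This term is the whole Theorems file that
would close the re-typed item. -/
theorem gapToContinuumR5_holds : GapToContinuumR5 :=
  fun _G _ _ _ _ _ _ _r _sch _T _Δ _ hYM hD => hYM.hasMassGap_of_hasDiagClustering hD

/-- The typed crux trivially implies R5 (R5 is outright true); recorded only so that the re-type is
visibly a WEAKENING of the obligation, never a strengthening. -/
theorem gapToContinuumR5_of_gapToContinuum (_h : GapToContinuum) : GapToContinuumR5 :=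
  gapToContinuumR5_holds

/-- **stmt-QuantumFields-16207 restated (R5 companion), paste-ready**: `OSLegsAtWeakCouplingC`
verbatim, last conjunct strengthened to `∃ Δ > 0, HasLatticeMassGap r sch Δ ∧ sch.HasDiagClustering r Δ`. -/
def OSLegsAtWeakCouplingR5 : Prop :=
  open Literature.MathematicalPhysics.QuantumFieldTheory in ∀ (G : Type) [Group G] [TopologicalSpace G] [IsTopologicalGroup G] [CompactSpace G], IsCompactSimpleLieGroup G → letI : MeasurableSpace G := borel G; haveI : BorelSpace G := ⟨rfl⟩; ∀ (r : LatticeRep G), ∀ (a : ℝ → ℝ), Continuous a → (∃ (Γ : ℝ → ℝ) (β₀ ℓ₀ c C : ℝ), 0 < ℓ₀ ∧ 0 < c ∧ (∀ β, 0 < a β) ∧ Filter.Tendsto a Filter.atTop (nhds 0) ∧ (∀ s : ℝ, 0 < s → s ≤ ℓ₀ → 0 < Γ s ∧ Γ s ≤ 1) ∧ ∀ (L : ℕ) [NeZero L] (β : ℝ), β₀ ≤ β → (L : ℝ) * a β ≤ ℓ₀ → let P : (Fin 4 → ZMod L) → Fin 4 → Fin 4 → GaugeConfig 4 L G → ℝ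 := fun x i j U => (r.N : ℝ) - (r.ρ (plaquetteHolonomy U x i j)).trace.re; let E : (GaugeConfig 4 L G → ℝ) → ℝ := fun F => wilsonExpectation (d := 4) (L := L) r.ρ β F; let cov : (GaugeConfig 4 L G → ℝ) → (GaugeConfig 4 L G → ℝ) → ℝ := fun F F' => E (fun U => F U * F' U) - E F * E F'; let dist : (Fin 4 → ZMod L) → (Fin 4 → ZMod L) → ℝ := fun x y => Real.sqrt (∑ k : Fin 4, (((x k - y k).valMinAbs : ℤ) : ℝ) ^ 2); (∀ n : ℕ, 1 ≤ n → 8 * n ≤ L → c * Γ ((n : ℝ) * a β) ≤ (n : ℝ) ^ 8 * cov (P 0 0 1) (P (Pi.single (2 : Fin 4) ((n : ℕ) : ZMod L)) 0 1) ∧ (n : ℝ) ^ 8 * cov (P 0 0 1) (P (Pi.single (2 : Fin 4) ((n : ℕ) : ZMod L)) 0 1) ≤ C * Γ ((n : ℝ) * a β)) ∧ (∀ (x y : Fin 4 → ZMod L) (i j i' j' : Fin 4), x ≠ y → i ≠ j → i' ≠ j' → |cov (P x i j) (P y i' j')| * dist x y ^ 8 ≤ C * Γ (dist x y * a β))) →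 (∃ (Γ₃ : ℝ → ℝ) (β₁ ℓ₁ c₃ : ℝ), 0 < ℓ₁ ∧ 0 < c₃ ∧ (∀ s : ℝ, 0 < s → s ≤ ℓ₁ → 0 < Γ₃ s) ∧ ∀ (L : ℕ) [NeZero L] (β : ℝ), β₁ ≤ β → (L : ℝ) * a β ≤ ℓ₁ → let P : (Fin 4 → ZMod L) → Fin 4 → Fin 4 → GaugeConfig 4 L G → ℝ := fun x i j U => (r.N : ℝ) - (r.ρ (plaquetteHolonomy U x i j)).trace.re; let E : (GaugeConfig 4 L G → ℝ) → ℝ := fun F => wilsonExpectation (d := 4) (L := L) r.ρ β F; let cov : (GaugeConfig 4 L G → ℝ) → (GaugeConfig 4 L G → ℝ) → ℝ := fun F F' => E (fun U => F U * F' U) - E F * E F'; ∀ n : ℕ, 1 ≤ n → 8 * n ≤ L → c₃ * Γ₃ ((n : ℝ) * a β) ≤ (n : ℝ) ^ 12 * |E (fun U => P 0 0 1 U * P (Pi.single (2 : Fin 4) ((n : ℕ) : ZMod L)) 0 1 U * P (Pi.single (3 : Fin 4) ((n : ℕ) : ZMod L)) 0 1 U) - E (P 0 0 1) * cov (P (Pi.single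 (2 : Fin 4) ((n : ℕ) : ZMod L)) 0 1) (P (Pi.single (3 : Fin 4) ((n : ℕ) : ZMod L)) 0 1) - E (P (Pi.single (2 : Fin 4) ((n : ℕ) : ZMod L)) 0 1) * cov (P 0 0 1) (P (Pi.single (3 : Fin 4) ((n : ℕ) : ZMod L)) 0 1) - E (P (Pi.single (3 : Fin 4) ((n : ℕ) : ZMod L)) 0 1) * cov (P 0 0 1) (P (Pi.single (2 : Fin 4) ((n : ℕ) : ZMod L)) 0 1) - E (P 0 0 1) * E (P (Pi.single (2 : Fin 4) ((n : ℕ) : ZMod L)) 0 1) * E (P (Pi.single (3 : Fin 4) ((n : ℕ) : ZMod L)) 0 1)|) → (∃ (c₁ β₂ : ℝ) (S₁ : ℝ → ℕ), 0 < c₁ ∧ ∀ A B : YMSpecies G, ∃ C : ℝ, ∀ β : ℝ, β₂ ≤ β → ∀ S n : ℕ, S₁ β ≤ S → n ≤ S → |latticeConnectedCorr r.ρ β (2 * S + 1) A.F B.F n| ≤ C * Real.exp (-(c₁ * a β * n))) → ∃ (sch : SpeciesScheme (YMSpecies G)) (T : OSData (YMSpecies G) 4), (∀ k, sch.a k = a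 (sch.β k)) ∧ sch.HasWeakCouplingLimit ∧ IsYangMillsFor r sch T ∧ T.IsNontrivial r.curvature ∧ T.IsNonGaussian r.curvature ∧ ∃ Δ > 0, HasLatticeMassGap r sch Δ ∧ sch.HasDiagClustering r Δ

/-- The restated 16207 implies the current one outright (drop the added conjunct). -/
theorem osLegsAtWeakCouplingC_of_R5 (h : OSLegsAtWeakCouplingR5) : OSLegsAtWeakCouplingC := by
  intro G _ _ _ _ hG r a ha hPa hSk hCl
  obtain ⟨sch, T, hsch, hW, hYM, hNT, hNG, Δ, hΔ, hlat, -⟩ := h G hG r a ha hPa hSk hCl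
  exact ⟨sch, T, hsch, hW, hYM, hNT, hNG, Δ, hΔ, hlat⟩

/-- **The deciding theorem with FOUR hypotheses** (the gap-transfer crux discharged inside). -/
theorem closes_R5 (hUV : FemtoCurvatureTwoPointC) (hSkew : FemtoCurvatureSkewnessC)
    (hIR : LatticeGapInUVUnitsC) (hOS : OSLegsAtWeakCouplingR5) : YangMills := by
  intro G _ _ _ _ hG
  letI : MeasurableSpace G := borel G
  haveI : BorelSpace G := ⟨rfl⟩
  obtain ⟨r⟩ := hG.2
  obtain ⟨a, ha, hPa, hSk⟩ := hSkew G hG r (hUV G hG r)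
  have hCl := hIR G hG r a ha hPa
  obtain ⟨sch, T, _, hW, hYM, hNT, hNG, Δ, hΔ, hlat, hD⟩ := hOS G hG r a ha hPa hSk hCl
  exact ⟨r, sch, T, hW, hYM, hNT, hNG, Δ, hΔ, hYM.hasMassGap_of_hasDiagClustering hD, hlat⟩

/-- **The deciding theorem keeping the crux slot** (five hypotheses, shape of today's `closes`; the
fifth is `GapToContinuumR5`, an item closed at once by `gapToContinuumR5_holds`). -/
theorem closes_R5' (hUV : FemtoCurvatureTwoPointC) (hSkew : FemtoCurvatureSkewnessC)
    (hIR : LatticeGapInUVUnitsC) (hOS : OSLegsAtWeakCouplingR5) (hGap : GapToContinuumR5) :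
    YangMills := by
  intro G _ _ _ _ hG
  letI : MeasurableSpace G := borel G
  haveI : BorelSpace G := ⟨rfl⟩
  obtain ⟨r⟩ := hG.2
  obtain ⟨a, ha, hPa, hSk⟩ := hSkew G hG r (hUV G hG r)
  have hCl := hIR G hG r a ha hPa
  obtain ⟨sch, T, _, hW, hYM, hNT, hNG, Δ, hΔ, hlat, hD⟩ := hOS G hG r a ha hPa hSk hCl
  exact ⟨r, sch, T, hW, hYM, hNT, hNG, Δ, hΔ, hGap G r sch T Δ hΔ hYM hD, hlat⟩

end Summit.QuantumFields.YangMills.Cruxes.GapToContinuum.RestatementA2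

end
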